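import Summits.CriticalPhenomena.Ising3D.Control2DUnboundedSpin
import Mathlib.Analysis.SpecialFunctions.Pow.Real
import Mathlib.Analysis.Convex.SpecificFunctions.Basic
import Mathlib.Tactic.Linarith
import Mathlib.Tactic.Positivity
import Mathlib.Tactic.Ring
import Mathlib.Tactic.FieldSimp
import HarnessLib

/-!
# Uniform signs of the sum-rule terms on the diagonal, for a bounded range of dimensions
(cell `pub-ising3x`, seat controls-1 gen 43; PAPER Appendix E — CONTROL-ONLY; part 4, block analysis for
`Control2DUnboundedSpectrumFree`)

HONEST FRAMING: lottery ticket; floor = tightest certified 3D Ising CFT bounds; no exact-solution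
claim without a proof. CONTROL-ONLY (`d = 2`, global `sl(2) × sl(2)` blocks); pure block analysis, no `CrossingData`;
nothing here is about `d = 3`, no certificate, functional or number of the record is touched, no new hypothesis.

WHAT THIS FILE ADDS. `Control2DUnboundedSpectrum.exists_nonzero_above` carries the convergence clause `OpeConvergent`.
To remove it (`Control2DUnboundedSpectrumFree`) one needs `Σ p_i < ∞` from the POINTWISE sum rule ALONE whenever all
non-zero coefficients sit at dimensions `≤ H`. This file supplies the block estimates: at two fixed diagonal points the
sum-rule term `F_-[g_{Δ,ℓ}](x,x)` of EVERY unitary label with `Δ ≤ H` is `≤ -c < 0`, uniformly —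

* `chiralBlock_quarter_gain`: `k_{2a}(1/4) + (a/4)(1/4)^a ≤ (1/3)^a k_{2a}(3/4)` (the ratio lemma of
  `Control2DUnboundedSpin` sharpened by the `m = 1` term `a_1 = a/2` of the series); `globalBlock_quarter_gain`:
  `g_{Δ,ℓ}(1/4,1/4) + (Δ/4)(1/4)^Δ ≤ (1/3)^Δ g_{Δ,ℓ}(3/4,3/4)` for unitary labels;
* `crossF_quarter_le`: `F_-[g](1/4,1/4) ≤ ((9/16)^s (1/3)^Δ - (1/16)^s) g(3/4,3/4) - (9/16)^s (Δ/4)(1/4)^Δ`;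
* **`exists_crossF_quarter_neg`** (the range `2s - δ ≤ Δ ≤ H`, at `x = 1/4`): for every `H` and `s > 0` there are
  `δ ∈ (0, s]` and `c > 0` with `F_-[g_{Δ,ℓ}](1/4,1/4) ≤ -c` for all unitary labels in the range — for `Δ ≥ 2s` the
  bracket `(9/16)^s (1/3)^Δ - (1/16)^s` is `≤ 0`, for `2s - δ ≤ Δ < 2s` it is `≤ (1/16)^s (3^δ - 1) ≤ (1/16)^s · 2δ`
  (Bernoulli, Mathlib's `rpow_one_add_le_one_add_mul_self`) against the envelope bound
  `g(3/4,3/4) ≤ 32K²` of `Control2DChiralEnvelope`, and `δ` is chosen small;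
* **`exists_crossF_low_neg`** (the range `Δ ≤ 2s - δ`, near `x = 1`): for `s, δ > 0` there are `x₂ ∈ [1/2,1)` and
  `c > 0` with `F_-[g_{Δ,ℓ}](x₂,x₂) ≤ -c` for all unitary labels with `Δ ≤ 2s - δ` — at `x₂ = 1 - t`:
  `F ≤ 2K² t^{2s-δ/2} - 2^{1-2s} t^{2s-δ}` (envelope with `ε = δ/4` against `g(t,t) ≥ 2t^Δ ≥ 2t^{2s-δ}`), negative once
  `2K² t^{δ/2} ≤ 2^{-2s}`.

NOT claimed: anything at `s = 0`; any value of the constants; anything off the two points.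

References: R. Rattazzi, V. S. Rychkov, E. Tonni, A. Vichi, JHEP 12 (2008) 031, §3 [cite: RattazziEtAl2008, §3];
F. A. Dolan, H. Osborn, Nucl. Phys. B 678 (2004) 491, §3 [cite: DolanOsborn2004, §3]. Tree: `hasSum_chiralBlock`,
`chiralCoeff_nonneg` (`Control2DTermwise`); `chiralCoeff_one_right'` (`Control2DIsingBlockOperator`); `chiralBlock_nonneg`
(`Control2DNonVacuity`); `rpow_le_chiralBlock`, `two_mul_rpow_le_globalBlock_diag`, `exists_globalBlock_diag_le_envelope`
(`Control2DChiralEnvelope`); `chiralBlock_le_rpow_mul` (`Control2DUnboundedSpin`); `crossF` (`Literature/…/SigmaEpsilonSystem`).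
Mathlib: `le_hasSum`, `HasSum.sub`, `rpow_one_add_le_one_add_mul_self`, `Real.rpow_le_rpow_of_exponent_ge`.
-/

namespace Summit.CriticalPhenomena.Ising3D.Control2D

open Set
open Literature.MathematicalPhysics.QuantumFieldTheory.ConformalBootstrap3D

/-! ### The quarter-point gain -/

/-- **The ratio lemma at `(1/4, 3/4)` sharpened by the linear term**: for `a ≥ 0`,
`k_{2a}(1/4) + (a/4)(1/4)^a ≤ (1/3)^a k_{2a}(3/4)` (termwise `(1/3)^a (3/4)^{a+m} - (1/4)^{a+m} = (1/4)^a((3/4)^m - (1/4)^m) ≥ 0`,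
and the `m = 1` term is `a_1 · (1/4)^a · (1/2) = (a/4)(1/4)^a`). [folklore] -/
theorem chiralBlock_quarter_gain {a : ℝ} (ha : 0 ≤ a) :
    chiralBlock a (1 / 4) + a / 4 * (1 / 4 : ℝ) ^ a ≤ (1 / 3 : ℝ) ^ a * chiralBlock a (3 / 4) := by
  have S1 := hasSum_chiralBlock a (x := 1 / 4) (by norm_num) (by norm_num)
  have S2 := (hasSum_chiralBlock a (x := 3 / 4) (by norm_num) (by norm_num)).mul_left ((1 / 3 : ℝ) ^ a)
  have hq0 : (0 : ℝ) < (1 / 4 : ℝ) ^ a := Real.rpow_pos_of_pos (by norm_num) a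
  -- the difference series
  have hD : HasSum (fun m : ℕ => chiralCoeff a m * (1 / 4 : ℝ) ^ a * ((3 / 4 : ℝ) ^ m - (1 / 4 : ℝ) ^ m))
      ((1 / 3 : ℝ) ^ a * chiralBlock a (3 / 4) - chiralBlock a (1 / 4)) := by
    refine (S2.sub S1).congr_fun fun m => ?_
    have e1 : (1 / 3 : ℝ) ^ a * (3 / 4 : ℝ) ^ a = (1 / 4 : ℝ) ^ a := by
      rw [← Real.mul_rpow (by norm_num) (by norm_num)]; norm_num
    rw [Real.rpow_add (by norm_num : (0 : ℝ) < 3 / 4), Real.rpow_add (by norm_num : (0 : ℝ) < 1 / 4),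
      Real.rpow_natCast, Real.rpow_natCast]
    calc chiralCoeff a m * (1 / 4 : ℝ) ^ a * ((3 / 4 : ℝ) ^ m - (1 / 4 : ℝ) ^ m)
        = chiralCoeff a m * ((1 / 3 : ℝ) ^ a * (3 / 4 : ℝ) ^ a) * (3 / 4 : ℝ) ^ m
          - chiralCoeff a m * ((1 / 4 : ℝ) ^ a * (1 / 4 : ℝ) ^ m) := by rw [e1]; ring
      _ = (1 / 3 : ℝ) ^ a * (chiralCoeff a m * ((3 / 4 : ℝ) ^ a * (3 / 4 : ℝ) ^ m))
          - chiralCoeff a m * ((1 / 4 : ℝ) ^ a * (1 / 4 : ℝ) ^ m) := by ring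
  have hnn : ∀ m, 0 ≤ chiralCoeff a m * (1 / 4 : ℝ) ^ a * ((3 / 4 : ℝ) ^ m - (1 / 4 : ℝ) ^ m) := fun m => by
    have : (1 / 4 : ℝ) ^ m ≤ (3 / 4 : ℝ) ^ m := pow_le_pow_left₀ (by norm_num) (by norm_num) m
    exact mul_nonneg (mul_nonneg (chiralCoeff_nonneg ha m) hq0.le) (by linarith)
  have h1 := le_hasSum hD 1 (fun m _ => hnn m)
  rw [chiralCoeff_one_right' ha] at h1
  norm_num at h1
  linarith

/-- **Quarter-point gain for the block**: for a unitary label `ℓ ≤ Δ`,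
`g_{Δ,ℓ}(1/4,1/4) + (Δ/4)(1/4)^Δ ≤ (1/3)^Δ g_{Δ,ℓ}(3/4,3/4)` (the gain of weight `a = (Δ+ℓ)/2 ≥ Δ/2` against
`k_{2b}(1/4) ≤ (1/3)^b k_{2b}(3/4)` and `k_{2b}(3/4) ≥ (3/4)^b`, `b = (Δ-ℓ)/2`). [folklore] -/
theorem globalBlock_quarter_gain {Δ : ℝ} {ℓ : ℕ} (hΔ : (ℓ : ℝ) ≤ Δ) :
    globalBlock Δ ℓ (1 / 4) (1 / 4) + Δ / 4 * (1 / 4 : ℝ) ^ Δ ≤ (1 / 3 : ℝ) ^ Δ * globalBlock Δ ℓ (3 / 4) (3 / 4) := by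
  have hℓ : (0 : ℝ) ≤ ℓ := Nat.cast_nonneg ℓ
  set a : ℝ := (Δ + ℓ) / 2 with ha_def
  set b : ℝ := (Δ - ℓ) / 2 with hb_def
  have ha : 0 ≤ a := by rw [ha_def]; linarith
  have hb : 0 ≤ b := by rw [hb_def]; linarith
  have hab : a + b = Δ := by rw [ha_def, hb_def]; ring
  have hq : (1 / 4 : ℝ) ∈ Ioo (0 : ℝ) 1 := ⟨by norm_num, by norm_num⟩
  have h34 : (3 / 4 : ℝ) ∈ Ioo (0 : ℝ) 1 := ⟨by norm_num, by norm_num⟩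
  have hA := chiralBlock_quarter_gain ha
  have hB : chiralBlock b (1 / 4) ≤ (1 / 3 : ℝ) ^ b * chiralBlock b (3 / 4) := by
    have := chiralBlock_le_rpow_mul hb (x₁ := 1 / 4) (x₂ := 3 / 4) (by norm_num) (by norm_num) (by norm_num)
    norm_num at this ⊢
    exact this
  have hB' : (3 / 4 : ℝ) ^ b ≤ chiralBlock b (3 / 4) := rpow_le_chiralBlock hb (by norm_num) (by norm_num)
  have hA0 : 0 ≤ chiralBlock a (1 / 4) := chiralBlock_nonneg ha hq
  have hB0 : 0 ≤ chiralBlock b (1 / 4) := chiralBlock_nonneg hb hq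
  have hA1 : 0 ≤ chiralBlock a (3 / 4) := chiralBlock_nonneg ha h34
  have h3a : 0 ≤ (1 / 3 : ℝ) ^ a := Real.rpow_nonneg (by norm_num) a
  have h3b : 0 ≤ (1 / 3 : ℝ) ^ b := Real.rpow_nonneg (by norm_num) b
  have h4a : 0 ≤ (1 / 4 : ℝ) ^ a := Real.rpow_nonneg (by norm_num) a
  -- rpow bookkeeping
  have e3 : (1 / 3 : ℝ) ^ a * (1 / 3 : ℝ) ^ b = (1 / 3 : ℝ) ^ Δ := by
    rw [← Real.rpow_add (by norm_num : (0 : ℝ) < 1 / 3), hab]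
  have e4 : (1 / 4 : ℝ) ^ a * ((1 / 3 : ℝ) ^ b * (3 / 4 : ℝ) ^ b) = (1 / 4 : ℝ) ^ Δ := by
    rw [← Real.mul_rpow (by norm_num) (by norm_num), show (1 / 3 : ℝ) * (3 / 4) = 1 / 4 by norm_num,
      ← Real.rpow_add (by norm_num : (0 : ℝ) < 1 / 4), hab]
  have hval1 : globalBlock Δ ℓ (1 / 4) (1 / 4) = 2 * (chiralBlock a (1 / 4) * chiralBlock b (1 / 4)) := by
    unfold globalBlock; rw [← ha_def, ← hb_def]; ring
  have hval3 : globalBlock Δ ℓ (3 / 4) (3 / 4) = 2 * (chiralBlock a (3 / 4) * chiralBlock b (3 / 4)) := by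
    unfold globalBlock; rw [← ha_def, ← hb_def]; ring
  rw [hval1, hval3]
  -- step 1: `A B ≤ ((1/3)^a A' - (a/4)(1/4)^a) · (1/3)^b B'`
  have step1 : chiralBlock a (1 / 4) * chiralBlock b (1 / 4) ≤
      ((1 / 3 : ℝ) ^ a * chiralBlock a (3 / 4) - a / 4 * (1 / 4 : ℝ) ^ a) * ((1 / 3 : ℝ) ^ b * chiralBlock b (3 / 4)) :=
    mul_le_mul (by linarith) hB hB0 (by linarith)
  -- step 2: the gain term, using `B' ≥ (3/4)^b` and `a ≥ Δ/2`
  have step2 : Δ / 4 * (1 / 4 : ℝ) ^ Δ ≤ a / 2 * (1 / 4 : ℝ) ^ a * ((1 / 3 : ℝ) ^ b * chiralBlock b (3 / 4)) := by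
    have haΔ : Δ / 4 ≤ a / 2 := by rw [ha_def]; linarith
    have h4Δ : 0 ≤ (1 / 4 : ℝ) ^ Δ := Real.rpow_nonneg (by norm_num) Δ
    calc Δ / 4 * (1 / 4 : ℝ) ^ Δ ≤ a / 2 * (1 / 4 : ℝ) ^ Δ := mul_le_mul_of_nonneg_right haΔ h4Δ
      _ = a / 2 * (1 / 4 : ℝ) ^ a * ((1 / 3 : ℝ) ^ b * (3 / 4 : ℝ) ^ b) := by rw [← e4]; ring
      _ ≤ a / 2 * (1 / 4 : ℝ) ^ a * ((1 / 3 : ℝ) ^ b * chiralBlock b (3 / 4)) :=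
          mul_le_mul_of_nonneg_left (mul_le_mul_of_nonneg_left hB' h3b) (by positivity)
  have e5 : ((1 / 3 : ℝ) ^ a * chiralBlock a (3 / 4)) * ((1 / 3 : ℝ) ^ b * chiralBlock b (3 / 4)) =
      (1 / 3 : ℝ) ^ Δ * (chiralBlock a (3 / 4) * chiralBlock b (3 / 4)) := by rw [← e3]; ring
  nlinarith [step1, step2, e5]

/-- **The sum-rule term at the quarter point**: for a unitary label and any `s`,
`F^{s}_-[g_{Δ,ℓ}](1/4,1/4) ≤ ((9/16)^s (1/3)^Δ - (1/16)^s) · g(3/4,3/4) - (9/16)^s (Δ/4)(1/4)^Δ`. [folklore] -/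
theorem crossF_quarter_le (s : ℝ) {Δ : ℝ} {ℓ : ℕ} (hΔ : (ℓ : ℝ) ≤ Δ) :
    crossF s (-1) (globalBlock Δ ℓ) (1 / 4) (1 / 4) ≤
      ((9 / 16 : ℝ) ^ s * (1 / 3 : ℝ) ^ Δ - (1 / 16 : ℝ) ^ s) * globalBlock Δ ℓ (3 / 4) (3 / 4)
        - (9 / 16 : ℝ) ^ s * (Δ / 4 * (1 / 4 : ℝ) ^ Δ) := by
  have h := globalBlock_quarter_gain hΔ
  have h9 : 0 ≤ (9 / 16 : ℝ) ^ s := Real.rpow_nonneg (by norm_num) s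
  have hF : crossF s (-1) (globalBlock Δ ℓ) (1 / 4) (1 / 4) =
      (9 / 16 : ℝ) ^ s * globalBlock Δ ℓ (1 / 4) (1 / 4) - (1 / 16 : ℝ) ^ s * globalBlock Δ ℓ (3 / 4) (3 / 4) := by
    simp only [crossF]; norm_num; ring
  rw [hF]
  nlinarith [mul_le_mul_of_nonneg_left h h9]

/-! ### Uniform negative sign at the quarter point for `2s - δ ≤ Δ ≤ H` -/

/-- `3^δ ≤ 1 + 2δ` for `0 ≤ δ ≤ 1` (Bernoulli). [folklore] -/
theorem three_rpow_le_one_add {δ : ℝ} (h0 : 0 ≤ δ) (h1 : δ ≤ 1) : (3 : ℝ) ^ δ ≤ 1 + 2 * δ := by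
  have h := rpow_one_add_le_one_add_mul_self (s := (2 : ℝ)) (by norm_num) h0 h1
  norm_num at h
  linarith [h]

/-- **Uniform sign at the quarter point.** For every `H` and `s > 0` there are `δ ∈ (0, s]` and `c > 0` such that every
unitary label with `2s - δ ≤ Δ ≤ H` has `F^{s}_-[g_{Δ,ℓ}](1/4,1/4) ≤ -c`. [folklore] -/
theorem exists_crossF_quarter_neg (H : ℝ) {s : ℝ} (hs : 0 < s) :
    ∃ δ c : ℝ, 0 < δ ∧ δ ≤ s ∧ 0 < c ∧ ∀ (Δ : ℝ) (ℓ : ℕ), (ℓ : ℝ) ≤ Δ → 2 * s - δ ≤ Δ → Δ ≤ H →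
      crossF s (-1) (globalBlock Δ ℓ) (1 / 4) (1 / 4) ≤ -c := by
  obtain ⟨K, hK0, hK⟩ := exists_globalBlock_diag_le_envelope H (ε := 1) one_pos
  -- `g(3/4,3/4) ≤ 2 (K/(1/4))² = 32 K²`
  set B : ℝ := 2 * (K / (1 - 3 / 4 : ℝ) ^ (1 : ℝ)) ^ 2 with hBdef
  have hB0 : 0 ≤ B := by positivity
  set c₀ : ℝ := (9 / 16 : ℝ) ^ s * (s / 4 * (1 / 4 : ℝ) ^ H) with hc₀
  have hc₀0 : 0 < c₀ := by positivity
  set δ : ℝ := min s (min 1 (c₀ / (4 * ((1 / 16 : ℝ) ^ s * B) + 1))) with hδ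
  have hden : 0 < 4 * ((1 / 16 : ℝ) ^ s * B) + 1 := by positivity
  have hδ0 : 0 < δ := lt_min hs (lt_min one_pos (div_pos hc₀0 hden))
  have hδs : δ ≤ s := min_le_left _ _
  have hδ1 : δ ≤ 1 := (min_le_right _ _).trans (min_le_left _ _)
  have hδc : δ ≤ c₀ / (4 * ((1 / 16 : ℝ) ^ s * B) + 1) := (min_le_right _ _).trans (min_le_right _ _)
  have hδB : 2 * δ * ((1 / 16 : ℝ) ^ s * B) ≤ c₀ / 2 := by
    have h1 : δ * (4 * ((1 / 16 : ℝ) ^ s * B) + 1) ≤ c₀ := by rwa [le_div_iff₀ hden] at hδc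
    nlinarith [h1, hδ0, hB0, Real.rpow_nonneg (by norm_num : (0:ℝ) ≤ 1 / 16) s,
      mul_nonneg (Real.rpow_nonneg (by norm_num : (0:ℝ) ≤ 1 / 16) s) hB0]
  refine ⟨δ, c₀ / 2, hδ0, hδs, by positivity, fun Δ ℓ hℓΔ hlo hhi => ?_⟩
  have hF := crossF_quarter_le s hℓΔ
  have hg0 : 0 ≤ globalBlock Δ ℓ (3 / 4) (3 / 4) := globalBlock_nonneg hℓΔ ⟨by norm_num, by norm_num⟩ ⟨by norm_num, by norm_num⟩
  have hgB : globalBlock Δ ℓ (3 / 4) (3 / 4) ≤ B := hK Δ ℓ hℓΔ hhi (3 / 4) (by norm_num) (by norm_num)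
  have h9 : 0 < (9 / 16 : ℝ) ^ s := Real.rpow_pos_of_pos (by norm_num) s
  have h16 : 0 < (1 / 16 : ℝ) ^ s := Real.rpow_pos_of_pos (by norm_num) s
  -- the gain term is at least `c₀`: `Δ/4 ≥ s/4` and `(1/4)^Δ ≥ (1/4)^H`
  have hgain : c₀ ≤ (9 / 16 : ℝ) ^ s * (Δ / 4 * (1 / 4 : ℝ) ^ Δ) := by
    rw [hc₀]
    apply mul_le_mul_of_nonneg_left _ h9.le
    have h1 : (1 / 4 : ℝ) ^ H ≤ (1 / 4 : ℝ) ^ Δ := Real.rpow_le_rpow_of_exponent_ge (by norm_num) (by norm_num) hhi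
    have h2 : s / 4 ≤ Δ / 4 := by linarith
    exact mul_le_mul h2 h1 (Real.rpow_nonneg (by norm_num) H) (by linarith)
  -- the bracket is at most `(1/16)^s · 2δ`
  have hbr : (9 / 16 : ℝ) ^ s * (1 / 3 : ℝ) ^ Δ - (1 / 16 : ℝ) ^ s ≤ (1 / 16 : ℝ) ^ s * (2 * δ) := by
    -- `(9/16)^s (1/3)^Δ ≤ (9/16)^s (1/3)^{2s-δ} = (1/16)^s 3^δ ≤ (1/16)^s (1 + 2δ)`
    have h1 : (1 / 3 : ℝ) ^ Δ ≤ (1 / 3 : ℝ) ^ (2 * s - δ) :=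
      Real.rpow_le_rpow_of_exponent_ge (by norm_num) (by norm_num) hlo
    have e1 : (1 / 3 : ℝ) ^ (2 * s - δ) = (1 / 9 : ℝ) ^ s * (3 : ℝ) ^ δ := by
      rw [Real.rpow_sub (by norm_num : (0 : ℝ) < 1 / 3), Real.rpow_mul (by norm_num : (0 : ℝ) ≤ 1 / 3),
        Real.rpow_two, show ((1 / 3 : ℝ) ^ 2) = 1 / 9 by norm_num, show (1 / 3 : ℝ) = (3 : ℝ)⁻¹ by norm_num,
        Real.inv_rpow (by norm_num : (0 : ℝ) ≤ 3), div_inv_eq_mul]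
    have e2 : (9 / 16 : ℝ) ^ s * (1 / 9 : ℝ) ^ s = (1 / 16 : ℝ) ^ s := by
      rw [← Real.mul_rpow (by norm_num) (by norm_num)]; norm_num
    have h3 : (3 : ℝ) ^ δ ≤ 1 + 2 * δ := three_rpow_le_one_add hδ0.le hδ1
    calc (9 / 16 : ℝ) ^ s * (1 / 3 : ℝ) ^ Δ - (1 / 16 : ℝ) ^ s
        ≤ (9 / 16 : ℝ) ^ s * (1 / 3 : ℝ) ^ (2 * s - δ) - (1 / 16 : ℝ) ^ s := by
          linarith [mul_le_mul_of_nonneg_left h1 h9.le]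
      _ = (1 / 16 : ℝ) ^ s * (3 : ℝ) ^ δ - (1 / 16 : ℝ) ^ s := by rw [e1, ← mul_assoc, e2]
      _ ≤ (1 / 16 : ℝ) ^ s * (1 + 2 * δ) - (1 / 16 : ℝ) ^ s := by
          linarith [mul_le_mul_of_nonneg_left h3 h16.le]
      _ = (1 / 16 : ℝ) ^ s * (2 * δ) := by ring
  -- combine
  have hprod : ((9 / 16 : ℝ) ^ s * (1 / 3 : ℝ) ^ Δ - (1 / 16 : ℝ) ^ s) * globalBlock Δ ℓ (3 / 4) (3 / 4) ≤
      (1 / 16 : ℝ) ^ s * (2 * δ) * B := by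
    calc ((9 / 16 : ℝ) ^ s * (1 / 3 : ℝ) ^ Δ - (1 / 16 : ℝ) ^ s) * globalBlock Δ ℓ (3 / 4) (3 / 4)
        ≤ (1 / 16 : ℝ) ^ s * (2 * δ) * globalBlock Δ ℓ (3 / 4) (3 / 4) := mul_le_mul_of_nonneg_right hbr hg0
      _ ≤ (1 / 16 : ℝ) ^ s * (2 * δ) * B := mul_le_mul_of_nonneg_left hgB (by positivity)
  have : (1 / 16 : ℝ) ^ s * (2 * δ) * B = 2 * δ * ((1 / 16 : ℝ) ^ s * B) := by ring
  linarith [hF, hprod, hgain, hδB]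

/-! ### Uniform negative sign near `x = 1` for `Δ ≤ 2s - δ` -/

/-- **Uniform sign near the corner for the low dimensions.** For `s, δ > 0` there are `x₂ ∈ [1/2, 1)` and `c > 0` such
that every unitary label with `Δ ≤ 2s - δ` has `F^{s}_-[g_{Δ,ℓ}](x₂,x₂) ≤ -c`: at `x₂ = 1 - t`,
`F = (t²)^s g(1-t,1-t) - (x₂²)^s g(t,t) ≤ 2K² t^{2s-δ/2} - 2^{1-2s} t^{2s-δ}` (the envelope of `Control2DChiralEnvelope`
with `ε = δ/4` on `[0, 2s]`; `g(t,t) ≥ 2t^Δ ≥ 2t^{2s-δ}`), which is `≤ -2^{-2s} t^{2s-δ}` once `2K² t^{δ/2} ≤ 2^{-2s}`.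
[folklore] -/
theorem exists_crossF_low_neg {s δ : ℝ} (hs : 0 < s) (hδ0 : 0 < δ) :
    ∃ x₂ c : ℝ, 1 / 2 ≤ x₂ ∧ x₂ < 1 ∧ 0 < c ∧ ∀ (Δ : ℝ) (ℓ : ℕ), (ℓ : ℝ) ≤ Δ → Δ ≤ 2 * s - δ →
      crossF s (-1) (globalBlock Δ ℓ) x₂ x₂ ≤ -c := by
  have hε : 0 < δ / 4 := by linarith
  obtain ⟨K, hK0, hK⟩ := exists_globalBlock_diag_le_envelope (2 * s) hε
  set q : ℝ := (1 / 2 : ℝ) ^ (2 * s) with hqdef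
  have hq0 : 0 < q := by positivity
  set t : ℝ := min (1 / 2) ((q / (2 * K ^ 2 + 1)) ^ (2 / δ)) with htdef
  have hM0 : 0 < 2 * K ^ 2 + 1 := by positivity
  have ht0 : 0 < t := lt_min (by norm_num) (Real.rpow_pos_of_pos (by positivity) _)
  have ht2 : t ≤ 1 / 2 := min_le_left _ _
  have htd : t ^ (δ / 2) ≤ q / (2 * K ^ 2 + 1) := by
    have h1 : t ^ (δ / 2) ≤ ((q / (2 * K ^ 2 + 1)) ^ (2 / δ)) ^ (δ / 2) :=
      Real.rpow_le_rpow ht0.le (min_le_right _ _) (by linarith)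
    rw [← Real.rpow_mul (by positivity), show 2 / δ * (δ / 2) = 1 by field_simp, Real.rpow_one] at h1
    exact h1
  have hKt : 2 * K ^ 2 * t ^ (δ / 2) ≤ q := by
    have := mul_le_mul_of_nonneg_left htd (by positivity : (0 : ℝ) ≤ 2 * K ^ 2)
    have e : 2 * K ^ 2 * (q / (2 * K ^ 2 + 1)) ≤ q := by
      rw [mul_div_assoc']
      exact div_le_of_le_mul₀ hM0.le hq0.le (by nlinarith)
    linarith
  refine ⟨1 - t, q * t ^ (2 * s - δ), by linarith, by linarith, by positivity, fun Δ ℓ hℓΔ hΔ => ?_⟩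
  have hℓ : (0 : ℝ) ≤ ℓ := Nat.cast_nonneg ℓ
  have hΔ0 : 0 ≤ Δ := hℓ.trans hℓΔ
  have hΔ2s : Δ ≤ 2 * s := by linarith
  have ht : t ∈ Ioo (0 : ℝ) 1 := ⟨ht0, by linarith⟩
  have h1t : (1 - t) ∈ Ioo (0 : ℝ) 1 := ⟨by linarith, by linarith⟩
  -- the two blocks
  have hgt : 2 * t ^ (2 * s - δ) ≤ globalBlock Δ ℓ t t := by
    have h1 := two_mul_rpow_le_globalBlock_diag hℓΔ ht0 ht.2
    have h2 : t ^ (2 * s - δ) ≤ t ^ Δ := Real.rpow_le_rpow_of_exponent_ge ht0 (by linarith) hΔ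
    linarith
  have hg1t : globalBlock Δ ℓ (1 - t) (1 - t) ≤ 2 * (K / t ^ (δ / 4)) ^ 2 := by
    have := hK Δ ℓ hℓΔ hΔ2s (1 - t) h1t.1 h1t.2
    rwa [sub_sub_cancel] at this
  have hKt2 : (K / t ^ (δ / 4)) ^ 2 = K ^ 2 / t ^ (δ / 2) := by
    rw [div_pow, ← Real.rpow_natCast (t ^ (δ / 4)) 2, ← Real.rpow_mul ht0.le]
    rw [show δ / 4 * ((2 : ℕ) : ℝ) = δ / 2 by push_cast; ring]
  rw [hKt2] at hg1t
  -- `F(x₂,x₂) = (t·t)^s g(1-t,1-t) - ((1-t)(1-t))^s g(t,t)`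
  have hF : crossF s (-1) (globalBlock Δ ℓ) (1 - t) (1 - t) =
      (t * t) ^ s * globalBlock Δ ℓ (1 - t) (1 - t) - ((1 - t) * (1 - t)) ^ s * globalBlock Δ ℓ t t := by
    simp only [crossF, sub_sub_cancel]; ring
  rw [hF]
  have htt : (t * t) ^ s = t ^ (2 * s) := by
    rw [Real.mul_rpow ht0.le ht0.le, ← Real.rpow_add ht0]; ring_nf
  have hxx : q ≤ ((1 - t) * (1 - t)) ^ s := by
    rw [Real.mul_rpow h1t.1.le h1t.1.le, hqdef, two_mul, Real.rpow_add (by norm_num : (0 : ℝ) < 1 / 2)]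
    have h1 : (1 / 2 : ℝ) ^ s ≤ (1 - t) ^ s := Real.rpow_le_rpow (by norm_num) (by linarith) hs.le
    exact mul_le_mul h1 h1 (by positivity) (Real.rpow_nonneg h1t.1.le s)
  have hts0 : 0 < t ^ (2 * s - δ) := Real.rpow_pos_of_pos ht0 _
  have htd0 : 0 < t ^ (δ / 2) := Real.rpow_pos_of_pos ht0 _
  -- `t^{2s} · 2K²/t^{δ/2} = 2K² t^{δ/2} · t^{2s-δ}`
  have e1 : t ^ (2 * s) * (2 * (K ^ 2 / t ^ (δ / 2))) = 2 * K ^ 2 * t ^ (δ / 2) * t ^ (2 * s - δ) := by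
    have : t ^ (2 * s) = t ^ (δ / 2) * t ^ (δ / 2) * t ^ (2 * s - δ) := by
      rw [← Real.rpow_add ht0, ← Real.rpow_add ht0]; ring_nf
    rw [this]; field_simp
  have hA : (t * t) ^ s * globalBlock Δ ℓ (1 - t) (1 - t) ≤ 2 * K ^ 2 * t ^ (δ / 2) * t ^ (2 * s - δ) := by
    rw [htt, ← e1]
    exact mul_le_mul_of_nonneg_left hg1t (Real.rpow_nonneg ht0.le _)
  have hB : 2 * q * t ^ (2 * s - δ) ≤ ((1 - t) * (1 - t)) ^ s * globalBlock Δ ℓ t t := by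
    calc 2 * q * t ^ (2 * s - δ) = q * (2 * t ^ (2 * s - δ)) := by ring
      _ ≤ ((1 - t) * (1 - t)) ^ s * globalBlock Δ ℓ t t :=
          mul_le_mul hxx hgt (by positivity) (Real.rpow_nonneg (mul_pos h1t.1 h1t.1).le s)
  have hC : 2 * K ^ 2 * t ^ (δ / 2) * t ^ (2 * s - δ) ≤ q * t ^ (2 * s - δ) :=
    mul_le_mul_of_nonneg_right hKt hts0.le
  linarith

end Summit.CriticalPhenomena.Ising3D.Control2D
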